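import Summits.QuantumFields.YangMills.Theorems.UnitScaleTiltProp7CovAgmonPieces
import HarnessLib

/-!
# Route `UnitScaleTilt`, crux K1 «MinimiserStabilityRegPr» (stmt-QuantumFields-19200), route-R E′ path (α′), S2 ∕ (E1-b) at the CURVED background — (D2′-cov) FILE 3b:
# ★★★ THE COVARIANT AGMON ESTIMATE — weighted-energy (exponential) screening for the pinned `Δ_U`-biharmonic least-squares problem on the torus at a unitary background,
# MODULO the covariant pinned Poincaré row (D1-cov) DISPLAYED in root form; the covariant twin of ✓ `Prop7PinnedBiharmonicAgmonDecay.weighted_laplace_le_core` with the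
# SAME constants

Cell `ym3-torus`, extra width seat `ym-routeR-w6` (gen 6); LOCATE `ym-routeR-w6/LOCATE-PCOV2-routeRw6g6.md` v1.1 (§1 (D2′-cov); §4: energy bricks are holonomy-blind).  THEOREMS ONLY
(0 `def`, 0 `sorry`); `--supports stmt-QuantumFields-19200`, count-neutral.  YM₃ on T³ is a ladder rung (R3), not the Clay problem; nothing here claims a stub, the crux, d = 4 or
the mass gap.

THE POINT.  The covariant (hK) rows of P-cov1 ✓p655977 are, by ✓ `Prop7CovInterpKernelDual`, `ℓ¹`-of-HS bounds `Σ_z‖Δ_Uw(z)‖_HS` for explicit pinned fields `w` solving a pinned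
least-squares problem with localized sources — exactly the situation of the flat (A-door) ✓p663210, whose decay input is the flat Agmon estimate ✓p660232.  This file is that
estimate at a unitary background `U`: DATA a scalar weight `ω > 0` with difference constants `a ≤ 1∕2`, `b`; the pinned covariant Poincaré row `√Σhs(v) ≤ A·√Σhs(Δ_Uv)`
((D1-cov) ✓p668134 in root form: `A = √C′_G·ℓ²`); a pinned `e` solving the EULER–LAGRANGE identity with three covariant source types
`Σ⟨Δ_Ue, Δ_Uv⟩ = Σ⟨h, Δ_Uv⟩ + Σ_{x,μ}⟨ht_μ, D_μv⟩ + Σ⟨s, v⟩` (pairing `Re Tr(X^*Y)`) for all pinned `v`; THEN with `E N G H Ht S` the `ω`-weighted HS-`ℓ²` sizes of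
`Δ_Ue, e, D_Ue, h, ht, s`: `E ≤ 3H + 2(g₁ + γA′)Ht + 2A′S`, `N ≤ A′E`, `G ≤ g₁E` under the flat file's two scale-free windows `H1`, `H2` (same `p γ A′ g₁ τ` at `c = 1`).  PROOF =
the flat proof line by line with `|·| ↦ √hs`, products ↦ pairings: FILE 2's weighted interpolation (STEP I), FILE 1's commutator bound at `θ = 1` + Minkowski + the Poincaré row
(STEP P), the EL identity tested with `v = ω²•e`, FILE 1's commutator bound at `θ = ω⁻¹` with ✓ `sq_weight_rows`, two-sided Cauchy–Schwarz, FILE 2's transport remainder.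

HONEST SCOPE.  (D1-cov) is DISPLAYED (its member-level frames are displayed in ✓p668134); the weight is DISPLAYED (consumer: ✓p660013's `exp(κρ∕ℓ)`); constants crude; the
covariant (EL-loc)∕(A-door)∕near-field transplant are NOT here.

References: T. Bałaban, CMP 96 (1984) 223–250 [Balaban1984PropagatorsII] ((1.9) p.226); CMP 99 (1985) 389–434 [Balaban1985BackgroundPropagators] ((3.8) p.392); CMP 99 (1985) 75–102
[Balaban1985RegularSpaces] ((1.14) p.78, (1.36) p.82); S. Agmon, Princeton Math. Notes 29 (1982) (method).
-/

set_option autoImplicit false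

noncomputable section

open scoped BigOperators Matrix.Norms.L2Operator Matrix

namespace Summit.QuantumFields.YangMills.Theorems.Prop7CovAgmonDecay

open Literature.MathematicalPhysics.QuantumFieldTheory.Balaban1983to89
open B10StarCount (shift_unshift unshift_shift)
open B9Eq39Adjoint (R covD covDstar divB)
open B9TorusCalculus (torusT torusT_apply torusT_symm_apply)
open Summit.QuantumFields.YangMills.Theorems.Prop7CovariantCoercivity (re_trace_conjTranspose_mul_self)
open Summit.QuantumFields.YangMills.Theorems.Prop7PinnedBiharmonicAgmonInterp (sq_weight_rows sqrt_comm_bound_le)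
open Summit.QuantumFields.YangMills.Theorems.Prop7CovAgmonLetters (hs_smul covD_smul_fun_src sum_hs_weighted_comm_le)
open Summit.QuantumFields.YangMills.Theorems.Prop7CovAgmonInterp (sum_re_trace_le_sqrt_mul_sqrt abs_sum_re_trace_le_sqrt_mul_sqrt re_trace_conjTranspose_mul_smul
  re_trace_smul_smul sqrt_sum_hs_add_le weighted_covGrad_sq_le sum_hs_sqweight_transport_le)
open Summit.QuantumFields.YangMills.Theorems.Prop7CovAgmonPieces (wt_hs el_lhs_ge el_h_le el_ht_le el_s_le sqrt_sum_hs_sqcomm_le sqrt_sum_hs_comm_le)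

variable {P : Params} {i : ℕ} {N : ℕ}

/-! ## §2 ★★★ The covariant Agmon estimate: (A) `N ≤ A′E`, `G ≤ g₁E`; (B) core form -/

section Core

variable {U : Fin P.d → Site P i → (Matrix (Fin N) (Fin N) ℂ)ˣ}

set_option maxHeartbeats 400000 in
/-- ★★ **(D2′-cov), PART A — Poincaré + weighted interpolation**: `N ≤ A′E` and `G ≤ g₁E` (STEPS I, P, G of the flat proof). [cite: Balaban1984PropagatorsII, (1.9) p.226] -/
theorem weighted_covLaplace_N_G_le (hU : ∀ ν x, (U ν x : Matrix (Fin N) (Fin N) ℂ) ∈ unitary (Matrix (Fin N) (Fin N) ℂ))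
    (C : Set (Site P i)) (ω : Site P i → ℝ) (e : Site P i → Matrix (Fin N) (Fin N) ℂ)
    {a b A p γ A' g₁ : ℝ} (ha0 : 0 ≤ a) (ha : a ≤ 1 / 2) (hb0 : 0 ≤ b) (hA : 0 ≤ A)
    (hω₀ : ∀ x, 0 < ω x)
    (hω₁ : ∀ x μ, |ω (x.shift μ) - ω x| ≤ a * ω x ∧ |ω (x.unshift μ) - ω x| ≤ a * ω x)
    (hω₂ : ∀ x μ, |ω (x.shift μ) + ω (x.unshift μ) - 2 * ω x| ≤ b * ω x)
    (hP : ∀ v : Site P i → Matrix (Fin N) (Fin N) ℂ, (∀ y ∈ C, v y = 0) →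
      Real.sqrt (∑ x, ∑ j : Fin N, ∑ k : Fin N, ‖(v x) j k‖ ^ 2)
        ≤ A * Real.sqrt (∑ x, ∑ j : Fin N, ∑ k : Fin N, ‖(divB (torusT P i) U (fun μ => covD (torusT P i) U μ v) x) j k‖ ^ 2))
    (he : ∀ y ∈ C, e y = 0)
    (hp : p = Real.sqrt (10 * P.d) * A * a) (hγ : γ = 15 / 4 * a * Real.sqrt P.d) (hA' : A' = 2 * A + 4 * p ^ 2)
    (hg₁ : g₁ = Real.sqrt (2 * A' + γ ^ 2 * A' ^ 2)) (H1 : p * γ + Real.sqrt 3 * P.d * b * A ≤ 1 / 4) :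
    Real.sqrt (∑ x, ω x ^ 2 * ∑ j : Fin N, ∑ k : Fin N, ‖(e x) j k‖ ^ 2)
        ≤ A' * Real.sqrt (∑ x, ω x ^ 2 * ∑ j : Fin N, ∑ k : Fin N, ‖(divB (torusT P i) U (fun μ => covD (torusT P i) U μ e) x) j k‖ ^ 2)
      ∧ Real.sqrt (∑ x, ∑ μ, ω x ^ 2 * ∑ j : Fin N, ∑ k : Fin N, ‖(covD (torusT P i) U μ e x) j k‖ ^ 2)
        ≤ g₁ * Real.sqrt (∑ x, ω x ^ 2 * ∑ j : Fin N, ∑ k : Fin N, ‖(divB (torusT P i) U (fun μ => covD (torusT P i) U μ e) x) j k‖ ^ 2) := by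
  have hd : (0 : ℝ) ≤ P.d := Nat.cast_nonneg _
  -- inputs (before naming, so that `set` abstracts them)
  have hI0 := weighted_covGrad_sq_le hU ω e ha0 ha hω₀ hω₁ hω₂
  have hR₁ := sqrt_sum_hs_comm_le hU ω e ha0 ha hb0 hω₀ hω₁ hω₂
  have hpin : ∀ y ∈ C, (fun x => (ω x) • e x) y = 0 := fun y hy => by simp [he y hy]
  have hP0 := hP _ hpin
  have hM := sqrt_sum_hs_add_le Finset.univ (fun x => (ω x) • divB (torusT P i) U (fun μ => covD (torusT P i) U μ e) x)
    (fun x => divB (torusT P i) U (fun μ => covD (torusT P i) U μ (fun y => (ω y) • e y)) x - (ω x) • divB (torusT P i) U (fun μ => covD (torusT P i) U μ e) x)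
  have e1 : ∀ x, (ω x) • divB (torusT P i) U (fun μ => covD (torusT P i) U μ e) x
      + (divB (torusT P i) U (fun μ => covD (torusT P i) U μ (fun y => (ω y) • e y)) x - (ω x) • divB (torusT P i) U (fun μ => covD (torusT P i) U μ e) x)
      = divB (torusT P i) U (fun μ => covD (torusT P i) U μ (fun y => (ω y) • e y)) x := fun x => by abel
  simp only [e1] at hM
  have hN' : ∑ x, ∑ j : Fin N, ∑ k : Fin N, ‖((fun x => (ω x) • e x) x) j k‖ ^ 2 = ∑ x, ω x ^ 2 * ∑ j : Fin N, ∑ k : Fin N, ‖(e x) j k‖ ^ 2 :=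
    Finset.sum_congr rfl fun x _ => (wt_hs (ω x) (e x)).symm
  have hE' : ∑ x, ∑ j : Fin N, ∑ k : Fin N, ‖((ω x) • divB (torusT P i) U (fun μ => covD (torusT P i) U μ e) x) j k‖ ^ 2
      = ∑ x, ω x ^ 2 * ∑ j : Fin N, ∑ k : Fin N, ‖(divB (torusT P i) U (fun μ => covD (torusT P i) U μ e) x) j k‖ ^ 2 :=
    Finset.sum_congr rfl fun x _ => (wt_hs (ω x) _).symm
  rw [hN'] at hP0
  rw [hE'] at hM
  -- names
  set E := Real.sqrt (∑ x, ω x ^ 2 * ∑ j : Fin N, ∑ k : Fin N, ‖(divB (torusT P i) U (fun μ => covD (torusT P i) U μ e) x) j k‖ ^ 2) with hEdef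
  set Nn := Real.sqrt (∑ x, ω x ^ 2 * ∑ j : Fin N, ∑ k : Fin N, ‖(e x) j k‖ ^ 2) with hNdef
  set G := Real.sqrt (∑ x, ∑ μ, ω x ^ 2 * ∑ j : Fin N, ∑ k : Fin N, ‖(covD (torusT P i) U μ e x) j k‖ ^ 2) with hGdef
  have hE0 : 0 ≤ E := Real.sqrt_nonneg _
  have hN0 : 0 ≤ Nn := Real.sqrt_nonneg _
  have hG0 : 0 ≤ G := Real.sqrt_nonneg _
  have hN2pos : 0 ≤ ∑ x, ω x ^ 2 * ∑ j : Fin N, ∑ k : Fin N, ‖(e x) j k‖ ^ 2 := Finset.sum_nonneg fun _ _ => by positivity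
  have hG2pos : 0 ≤ ∑ x, ∑ μ, ω x ^ 2 * ∑ j : Fin N, ∑ k : Fin N, ‖(covD (torusT P i) U μ e x) j k‖ ^ 2 :=
    Finset.sum_nonneg fun _ _ => Finset.sum_nonneg fun _ _ => by positivity
  have hNsq : Nn ^ 2 = ∑ x, ω x ^ 2 * ∑ j : Fin N, ∑ k : Fin N, ‖(e x) j k‖ ^ 2 := Real.sq_sqrt hN2pos
  have hGsq : G ^ 2 = ∑ x, ∑ μ, ω x ^ 2 * ∑ j : Fin N, ∑ k : Fin N, ‖(covD (torusT P i) U μ e x) j k‖ ^ 2 := Real.sq_sqrt hG2pos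
  have hp0 : 0 ≤ p := by rw [hp]; positivity
  have hγ0 : 0 ≤ γ := by rw [hγ]; positivity
  have hA'0 : 0 ≤ A' := by rw [hA']; positivity
  have hI : G ^ 2 ≤ 2 * Nn * E + γ ^ 2 * Nn ^ 2 := by rw [hGsq, hNsq, hγ]; exact hI0
  have hP1 : Nn ≤ A * E + p * G + Real.sqrt 3 * P.d * b * A * Nn := by
    have h3 := hM.trans (add_le_add le_rfl hR₁)
    calc Nn ≤ _ := hP0
      _ ≤ A * (E + (Real.sqrt (10 * P.d) * a * G + Real.sqrt 3 * P.d * b * Nn)) := mul_le_mul_of_nonneg_left h3 hA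
      _ = A * E + p * G + Real.sqrt 3 * P.d * b * A * Nn := by rw [hp]; ring
  have hpG : p * G ≤ Nn / 4 + 2 * p ^ 2 * E + p * γ * Nn := by
    have hR : 0 ≤ Nn / 4 + 2 * p ^ 2 * E + p * γ * Nn := by positivity
    have k0 : (p * G) ^ 2 ≤ p ^ 2 * (2 * Nn * E + γ ^ 2 * Nn ^ 2) := by
      rw [mul_pow]; exact mul_le_mul_of_nonneg_left hI (sq_nonneg p)
    have k1 : p ^ 2 * (2 * Nn * E + γ ^ 2 * Nn ^ 2) ≤ (Nn / 4 + 2 * p ^ 2 * E + p * γ * Nn) ^ 2 := by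
      have e1 : (Nn / 4 + 2 * p ^ 2 * E + p * γ * Nn) ^ 2 - p ^ 2 * (2 * Nn * E + γ ^ 2 * Nn ^ 2)
          = (Nn / 4 - 2 * p ^ 2 * E) ^ 2 + 2 * ((Nn / 4 + 2 * p ^ 2 * E) * (p * γ * Nn)) := by ring
      have e2 : 0 ≤ (Nn / 4 - 2 * p ^ 2 * E) ^ 2 + 2 * ((Nn / 4 + 2 * p ^ 2 * E) * (p * γ * Nn)) := by positivity
      linarith [e1, e2]
    exact (abs_le_of_sq_le_sq' (k0.trans k1) hR).2
  have hN : Nn ≤ A' * E := by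
    have h1 : (p * γ + Real.sqrt 3 * P.d * b * A) * Nn ≤ 1 / 4 * Nn := mul_le_mul_of_nonneg_right H1 hN0
    have e1 : (p * γ + Real.sqrt 3 * P.d * b * A) * Nn = p * γ * Nn + Real.sqrt 3 * P.d * b * A * Nn := by ring
    have h2 : Nn ≤ 2 * (A * E) + 2 * (2 * p ^ 2 * E) := by linarith [hP1, hpG, h1, e1]
    calc Nn ≤ 2 * (A * E) + 2 * (2 * p ^ 2 * E) := h2
      _ = A' * E := by rw [hA']; ring
  have hGle : G ≤ g₁ * E := by
    have h1 : G ^ 2 ≤ (g₁ * E) ^ 2 := by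
      have h2 : Nn * E ≤ A' * E * E := mul_le_mul_of_nonneg_right hN hE0
      have h3 : γ ^ 2 * Nn ^ 2 ≤ γ ^ 2 * (A' * E) ^ 2 := mul_le_mul_of_nonneg_left (pow_le_pow_left₀ hN0 hN 2) (sq_nonneg γ)
      have hg₁sq : g₁ ^ 2 = 2 * A' + γ ^ 2 * A' ^ 2 := by rw [hg₁]; exact Real.sq_sqrt (by positivity)
      calc G ^ 2 ≤ 2 * Nn * E + γ ^ 2 * Nn ^ 2 := hI
        _ ≤ 2 * (A' * E * E) + γ ^ 2 * (A' * E) ^ 2 := by linarith [h2, h3]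
        _ = g₁ ^ 2 * E ^ 2 := by rw [hg₁sq]; ring
        _ = (g₁ * E) ^ 2 := by ring
    have hg₁0 : 0 ≤ g₁ := by rw [hg₁]; positivity
    exact (abs_le_of_sq_le_sq' h1 (by positivity)).2
  exact ⟨hN, hGle⟩

set_option maxHeartbeats 400000 in
/-- ★★★ **(D2′-cov) AGMON, CORE FORM** — see the module docstring; covariant twin of ✓ `Prop7PinnedBiharmonicAgmonDecay.weighted_laplace_le_core` (same constants, `c = 1`).
[cite: Balaban1984PropagatorsII, (1.9) p.226; Balaban1985BackgroundPropagators, (3.8) p.392] -/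
theorem weighted_covLaplace_le_core (hU : ∀ ν x, (U ν x : Matrix (Fin N) (Fin N) ℂ) ∈ unitary (Matrix (Fin N) (Fin N) ℂ))
    (C : Set (Site P i)) (ω : Site P i → ℝ) (e h s : Site P i → Matrix (Fin N) (Fin N) ℂ) (ht : Fin P.d → Site P i → Matrix (Fin N) (Fin N) ℂ)
    {a b A p γ A' g₁ τ : ℝ} (ha0 : 0 ≤ a) (ha : a ≤ 1 / 2) (hb0 : 0 ≤ b) (hA : 0 ≤ A)
    (hω₀ : ∀ x, 0 < ω x)
    (hω₁ : ∀ x μ, |ω (x.shift μ) - ω x| ≤ a * ω x ∧ |ω (x.unshift μ) - ω x| ≤ a * ω x)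
    (hω₂ : ∀ x μ, |ω (x.shift μ) + ω (x.unshift μ) - 2 * ω x| ≤ b * ω x)
    (hP : ∀ v : Site P i → Matrix (Fin N) (Fin N) ℂ, (∀ y ∈ C, v y = 0) →
      Real.sqrt (∑ x, ∑ j : Fin N, ∑ k : Fin N, ‖(v x) j k‖ ^ 2)
        ≤ A * Real.sqrt (∑ x, ∑ j : Fin N, ∑ k : Fin N, ‖(divB (torusT P i) U (fun μ => covD (torusT P i) U μ v) x) j k‖ ^ 2))
    (he : ∀ y ∈ C, e y = 0)
    (hEL : ∀ v : Site P i → Matrix (Fin N) (Fin N) ℂ, (∀ y ∈ C, v y = 0) →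
      ∑ x, (((divB (torusT P i) U (fun μ => covD (torusT P i) U μ e) x)ᴴ * divB (torusT P i) U (fun μ => covD (torusT P i) U μ v) x).trace).re
        = ∑ x, (((h x)ᴴ * divB (torusT P i) U (fun μ => covD (torusT P i) U μ v) x).trace).re
          + ∑ x, ∑ μ, (((ht μ x)ᴴ * covD (torusT P i) U μ v x).trace).re
          + ∑ x, (((s x)ᴴ * v x).trace).re)
    (hp : p = Real.sqrt (10 * P.d) * A * a) (hγ : γ = 15 / 4 * a * Real.sqrt P.d) (hA' : A' = 2 * A + 4 * p ^ 2)
    (hg₁ : g₁ = Real.sqrt (2 * A' + γ ^ 2 * A' ^ 2))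
    (hτ : τ = Real.sqrt (10 * P.d) * (5 / 2 * a) * g₁ + Real.sqrt 3 * P.d * (2 * a ^ 2 + 2 * b) * A')
    (H1 : p * γ + Real.sqrt 3 * P.d * b * A ≤ 1 / 4) (H2 : τ ≤ 1 / 2) :
    Real.sqrt (∑ x, ω x ^ 2 * ∑ j : Fin N, ∑ k : Fin N, ‖(divB (torusT P i) U (fun μ => covD (torusT P i) U μ e) x) j k‖ ^ 2)
        ≤ 3 * Real.sqrt (∑ x, ω x ^ 2 * ∑ j : Fin N, ∑ k : Fin N, ‖(h x) j k‖ ^ 2)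
          + 2 * (g₁ + γ * A') * Real.sqrt (∑ x, ∑ μ, ω x ^ 2 * ∑ j : Fin N, ∑ k : Fin N, ‖(ht μ x) j k‖ ^ 2)
          + 2 * A' * Real.sqrt (∑ x, ω x ^ 2 * ∑ j : Fin N, ∑ k : Fin N, ‖(s x) j k‖ ^ 2)
      ∧ Real.sqrt (∑ x, ω x ^ 2 * ∑ j : Fin N, ∑ k : Fin N, ‖(e x) j k‖ ^ 2)
          ≤ A' * Real.sqrt (∑ x, ω x ^ 2 * ∑ j : Fin N, ∑ k : Fin N, ‖(divB (torusT P i) U (fun μ => covD (torusT P i) U μ e) x) j k‖ ^ 2)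
      ∧ Real.sqrt (∑ x, ∑ μ, ω x ^ 2 * ∑ j : Fin N, ∑ k : Fin N, ‖(covD (torusT P i) U μ e x) j k‖ ^ 2)
          ≤ g₁ * Real.sqrt (∑ x, ω x ^ 2 * ∑ j : Fin N, ∑ k : Fin N, ‖(divB (torusT P i) U (fun μ => covD (torusT P i) U μ e) x) j k‖ ^ 2) := by
  have hd : (0 : ℝ) ≤ P.d := Nat.cast_nonneg _
  -- inputs (before naming)
  obtain ⟨hN, hGle⟩ := weighted_covLaplace_N_G_le hU C ω e ha0 ha hb0 hA hω₀ hω₁ hω₂ hP he hp hγ hA' hg₁ H1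
  have hpin2 : ∀ y ∈ C, (fun z => (ω z ^ 2) • e z) y = 0 := fun y hy => by simp [he y hy]
  have hEL2 := hEL _ hpin2
  have hcomm := sqrt_sum_hs_sqcomm_le hU ω e ha0 ha hb0 hω₀ hω₁ hω₂
  have hL := el_lhs_ge (U := U) ω hω₀ e
  have hT1 := el_h_le (U := U) ω hω₀ e h
  have hT2 := el_ht_le hU ω e ht ha0 ha hω₀ hω₁ hω₂
  have hT3 := el_s_le ω e s
  rw [← hγ] at hT2
  -- names
  set E := Real.sqrt (∑ x, ω x ^ 2 * ∑ j : Fin N, ∑ k : Fin N, ‖(divB (torusT P i) U (fun μ => covD (torusT P i) U μ e) x) j k‖ ^ 2) with hEdef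
  set Nn := Real.sqrt (∑ x, ω x ^ 2 * ∑ j : Fin N, ∑ k : Fin N, ‖(e x) j k‖ ^ 2) with hNdef
  set G := Real.sqrt (∑ x, ∑ μ, ω x ^ 2 * ∑ j : Fin N, ∑ k : Fin N, ‖(covD (torusT P i) U μ e x) j k‖ ^ 2) with hGdef
  set H := Real.sqrt (∑ x, ω x ^ 2 * ∑ j : Fin N, ∑ k : Fin N, ‖(h x) j k‖ ^ 2) with hHdef
  set Ht := Real.sqrt (∑ x, ∑ μ, ω x ^ 2 * ∑ j : Fin N, ∑ k : Fin N, ‖(ht μ x) j k‖ ^ 2) with hHtdef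
  set S := Real.sqrt (∑ x, ω x ^ 2 * ∑ j : Fin N, ∑ k : Fin N, ‖(s x) j k‖ ^ 2) with hSdef
  set Rr := Real.sqrt (∑ x, ∑ j : Fin N, ∑ k : Fin N, ‖((ω x)⁻¹ • (divB (torusT P i) U (fun μ => covD (torusT P i) U μ (fun z => (ω z ^ 2) • e z)) x
        - (ω x ^ 2) • divB (torusT P i) U (fun μ => covD (torusT P i) U μ e) x)) j k‖ ^ 2) with hRdef
  have hE0 : 0 ≤ E := Real.sqrt_nonneg _
  have hN0 : 0 ≤ Nn := Real.sqrt_nonneg _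
  have hG0 : 0 ≤ G := Real.sqrt_nonneg _
  have hH0 : 0 ≤ H := Real.sqrt_nonneg _
  have hHt0 : 0 ≤ Ht := Real.sqrt_nonneg _
  have hS0 : 0 ≤ S := Real.sqrt_nonneg _
  have hR0 : 0 ≤ Rr := Real.sqrt_nonneg _
  have hp0 : 0 ≤ p := by rw [hp]; positivity
  have hγ0 : 0 ≤ γ := by rw [hγ]; positivity
  have hA'0 : 0 ≤ A' := by rw [hA']; positivity
  have hg₁0 : 0 ≤ g₁ := by rw [hg₁]; positivity
  have hRle : Rr ≤ τ * E := by
    have h3 : Real.sqrt (10 * P.d) * (5 / 2 * a) * G ≤ Real.sqrt (10 * P.d) * (5 / 2 * a) * (g₁ * E) :=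
      mul_le_mul_of_nonneg_left hGle (by positivity)
    have h4 : Real.sqrt 3 * P.d * (2 * a ^ 2 + 2 * b) * Nn ≤ Real.sqrt 3 * P.d * (2 * a ^ 2 + 2 * b) * (A' * E) :=
      mul_le_mul_of_nonneg_left hN (by positivity)
    calc Rr ≤ _ := hcomm
      _ ≤ Real.sqrt (10 * P.d) * (5 / 2 * a) * (g₁ * E) + Real.sqrt 3 * P.d * (2 * a ^ 2 + 2 * b) * (A' * E) := add_le_add h3 h4
      _ = τ * E := by rw [hτ]; ring
  -- COMBINE
  have hmain : E ^ 2 ≤ τ * E ^ 2 + (1 + τ) * H * E + ((g₁ + γ * A') * Ht + A' * S) * E := by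
    have h1 : E ^ 2 - E * Rr ≤ H * E + H * Rr + (Ht * G + Ht * (γ * Nn)) + S * Nn := by
      rw [hEL2] at hL; linarith [hT1, hT2, hT3]
    have h2 : E * Rr ≤ E * (τ * E) := mul_le_mul_of_nonneg_left hRle hE0
    have h3 : H * Rr ≤ H * (τ * E) := mul_le_mul_of_nonneg_left hRle hH0
    have h4 : Ht * G ≤ Ht * (g₁ * E) := mul_le_mul_of_nonneg_left hGle hHt0
    have h5 : Ht * (γ * Nn) ≤ Ht * (γ * (A' * E)) := mul_le_mul_of_nonneg_left (mul_le_mul_of_nonneg_left hN hγ0) hHt0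
    have h6 : S * Nn ≤ S * (A' * E) := mul_le_mul_of_nonneg_left hN hS0
    calc E ^ 2 ≤ E * Rr + H * E + H * Rr + (Ht * G + Ht * (γ * Nn)) + S * Nn := by linarith [h1]
      _ ≤ E * (τ * E) + H * E + H * (τ * E) + (Ht * (g₁ * E) + Ht * (γ * (A' * E))) + S * (A' * E) :=
          add_le_add (add_le_add (add_le_add (add_le_add h2 le_rfl) h3) (add_le_add h4 h5)) h6
      _ = τ * E ^ 2 + (1 + τ) * H * E + ((g₁ + γ * A') * Ht + A' * S) * E := by ring
  have hτ0 : 0 ≤ τ := by rw [hτ]; positivity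
  have hK0 : 0 ≤ (g₁ + γ * A') * Ht + A' * S := by positivity
  have hfin : E ≤ 3 * H + 2 * (g₁ + γ * A') * Ht + 2 * A' * S := by
    by_cases hEz : E = 0
    · rw [hEz]; positivity
    · have hEpos : 0 < E := lt_of_le_of_ne hE0 (Ne.symm hEz)
      have h0 : E * E ≤ (τ * E + (1 + τ) * H + ((g₁ + γ * A') * Ht + A' * S)) * E := by
        have e1 : (τ * E + (1 + τ) * H + ((g₁ + γ * A') * Ht + A' * S)) * E
            = τ * E ^ 2 + (1 + τ) * H * E + ((g₁ + γ * A') * Ht + A' * S) * E := by ring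
        rw [e1, ← pow_two]; exact hmain
      have h1 : E ≤ τ * E + (1 + τ) * H + ((g₁ + γ * A') * Ht + A' * S) := le_of_mul_le_mul_right h0 hEpos
      have h2 : τ * E ≤ 1 / 2 * E := mul_le_mul_of_nonneg_right H2 hE0
      have h3 : τ * H ≤ 1 / 2 * H := mul_le_mul_of_nonneg_right H2 hH0
      have e2 : (1 + τ) * H = H + τ * H := by ring
      linarith [h1, h2, h3, e2]
  exact ⟨hfin, hN, hGle⟩

end Core

end Summit.QuantumFields.YangMills.Theorems.Prop7CovAgmonDecay

end
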